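import Summits.CriticalPhenomena.PercolationContinuityZ3.Theorems.PercNearOneGluingNoHeavyLowerTailSunflowerBernsteinCertificate
import Summits.CriticalPhenomena.PercolationContinuityZ3.Theorems.PercNearOneGluingNoHeavyLowerTailSunflowerAntipodalGladkov
import HarnessLib

/-!
# `NoHeavyLowerTail` (crux stmt-CriticalPhenomena-4575), abstract sunflower cubic at LAW level: BERNSTEIN REGION CERTIFICATES for (C1)
# — a reflected checker (soundness theorem + compiled test) for `e₃(c) ≤ max(a,b)·(ab − e₂(c))` on ONE sunflower at EVERY bias

Support file (seat `prim-ineq-gen-2` gen 33; `--supports stmt-CriticalPhenomena-4575`).  No `sorry`, no named facts, standard axioms; the only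
computation is in the files that USE the checker (`native_decide` on `certSide`, proposed `--computational`).
Memo: run/shared/lean/prim/prim-ineq-gen-2/REGION-CERTIFICATES-GEN33.md.

SETTING.  A three-petal sunflower of up-sets on `n` coins (`SunflowerPartition.Sunflower (Fin n)`, labelling `lab : 2^[n] → M₃`, `0` bottom,
`1,2,3` petals, `4` core) and a bias vector `x ∈ [0,1]^n`.  The cell masses `a = μ(A)`, `b = μ(B)`, `c_k = μ(C_k)` of the product measure
are the multi-affine polynomials `cellMass F ℓ x = Σ_{S : lab S = ℓ} Π_{i∈S} x_i Π_{i∉S} (1 − x_i)`, so the two cubics of the lineage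
`LA = a(ab − e₂(c)) − e₃(c)` and `LB = b(ab − e₂(c)) − e₃(c)` are polynomials of degree `≤ 3` in each `x_i`, and `a − b` is multi-affine.
(C1) for `F` at every bias is `[a ≥ b ⟹ LA ≥ 0] ∧ [b ≥ a ⟹ LB ≥ 0]`.

THE CERTIFICATE (this work).  A BERNSTEIN REGION CERTIFICATE for the A-side is a positive integer `N` and two coefficient tables `S₁`
(degree `≤ 2` per variable) and `S₂` (degree `≤ 1`) such that `S₁`, `S₂` and `S₀ := N·LA − (a−b)·S₁ − (a−b)²·S₂` all pass prove-1's scaled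
tensor-Bernstein test `Bern.certifyA` (…SunflowerBernsteinCertificate: nonnegative scaled Bernstein coefficients, hence `≥ 0` on the cube).
Then `N·LA = S₀ + (a−b)S₁ + (a−b)²S₂ ≥ 0` wherever `a ≥ b`.  Dually for the B-side with `b − a`.
* `ptPoly`, `cellPoly`, `eval_cellPoly` — point weights and cell masses as `Bern.Poly n 1` (multi-affine dense polynomials);
* `laArr`, `lbArr`, `dArr`, `ndArr` — the coefficient TABLES of `LA`, `LB`, `a − b`, `b − a` (products via `Bern.prodFinA`), with
  `eval_laArr`, `eval_lbArr`, `eval_dArr`, `eval_ndArr`;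
* `certSide n T D N S₁ S₂ : Bool` and **`eval_nonneg_of_certSide`**: a certified table `T` is nonnegative on `{x ∈ [0,1]^n : D(x) ≥ 0}`;
* **`c1_of_certs`**: two certificates (A-side for `laArr` on `a ≥ b`, B-side for `lbArr` on `b ≥ a`) give (C1) for `F` at EVERY bias
  `x ∈ [0,1]^n`: `c₁c₂c₃ ≤ max(a,b)·(ab − (c₁c₂ + c₁c₃ + c₂c₃))`.
WHY.  Such certificates are found by a linear programme (the unknowns are the Bernstein coefficients of `S₁, S₂`); the census of gen 33
(kit j226385 / j226406 / j226412 / j226405) finds them, with `N·S_k` integral and ≤ 15 nonzero coefficients, for EVERY bi-saturated three-petal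
class on `≤ 5` coins that was tested (all 146 classes on 4 coins, 425 sampled classes on 5 coins) — including all the p-SWITCHER classes, for
which no p-free stratum (BK, meet–join, additive domination) can exist.  This file is the kernel-checkable form of that census.
-/

namespace Summit.CriticalPhenomena.PercolationContinuityZ3.Theorems.SunflowerPartition

namespace SafeCalc

namespace C1Cert

open Finset Bern

variable {n : ℕ}

/-! ## Point weights and cell masses as multi-affine polynomials -/

/-- Per-coordinate coefficient of the weight of the point `S`: `X` on `S`, `1 − X` off `S`. [this work] -/
def ptCoef (S : Finset (Fin n)) (i : Fin n) (m : Fin 2) : ℤ :=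
  if i ∈ S then (if (m : ℕ) = 1 then 1 else 0) else (if (m : ℕ) = 0 then 1 else -1)

/-- The weight `Π_{i∈S} X_i · Π_{i∉S} (1 − X_i)` of the point `S ∈ 2^[n]` as a multi-affine polynomial. [this work] -/
def ptPoly (S : Finset (Fin n)) : Poly n 1 := fun e => ∏ i, ptCoef S i (e i)

/-- The per-coordinate factor of a point weight. [this work] -/
theorem sum_ptCoef (S : Finset (Fin n)) (i : Fin n) (t : ℝ) :
    ∑ m : Fin 2, (ptCoef S i m : ℝ) * t ^ (m : ℕ) = if i ∈ S then t else 1 - t := by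
  rw [Fin.sum_univ_two]
  by_cases hi : i ∈ S
  · simp [ptCoef, hi]
  · simp [ptCoef, hi]; ring

/-- Evaluation of a point weight. [this work] -/
theorem eval_ptPoly (S : Finset (Fin n)) (x : Fin n → ℝ) :
    eval (ptPoly S) x = (∏ i ∈ S, x i) * ∏ i ∈ Sᶜ, (1 - x i) := by
  classical
  simp only [eval, ptPoly, mono, Int.cast_prod, ← prod_mul_distrib]
  rw [← Fintype.piFinset_univ, ← Finset.prod_univ_sum (fun _ => (univ : Finset (Fin 2)))
    (fun i (m : Fin 2) => (ptCoef S i m : ℝ) * x i ^ (m : ℕ))]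
  simp only [sum_ptCoef]
  rw [prod_ite, filter_mem_eq_inter, univ_inter]
  congr 1
  refine prod_congr ?_ fun _ _ => rfl
  ext i; simp

/-- A point weight is nonnegative on the unit cube. [this work] -/
theorem eval_ptPoly_nonneg (S : Finset (Fin n)) {x : Fin n → ℝ} (hx : ∀ i, 0 ≤ x i ∧ x i ≤ 1) : 0 ≤ eval (ptPoly S) x := by
  rw [eval_ptPoly]
  exact mul_nonneg (prod_nonneg fun i _ => (hx i).1) (prod_nonneg fun i _ => sub_nonneg.2 (hx i).2)

variable (F : Sunflower (Fin n))

/-- The CELL POLYNOMIAL of label `ℓ`: total weight of the points labelled `ℓ` (`0` bottom, `1,2,3` petals, `4` core). [this work] -/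
def cellPoly (ℓ : Fin 5) : Poly n 1 := ∑ S : Finset (Fin n), if F.lab S = ℓ then ptPoly S else 0

/-- The CELL MASS of label `ℓ` under the product measure with biases `x`. [this work] -/
def cellMass (ℓ : Fin 5) (x : Fin n → ℝ) : ℝ :=
  ∑ S : Finset (Fin n), if F.lab S = ℓ then (∏ i ∈ S, x i) * ∏ i ∈ Sᶜ, (1 - x i) else 0

/-- The cell polynomial evaluates to the cell mass. [this work] -/
theorem eval_cellPoly (ℓ : Fin 5) (x : Fin n → ℝ) : eval (cellPoly F ℓ) x = cellMass F ℓ x := by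
  unfold cellPoly cellMass
  rw [eval_sum]
  refine sum_congr rfl fun S _ => ?_
  split_ifs
  · exact eval_ptPoly S x
  · exact eval_zero x

/-- Cell masses are nonnegative on the cube. [this work] -/
theorem cellMass_nonneg (ℓ : Fin 5) {x : Fin n → ℝ} (hx : ∀ i, 0 ≤ x i ∧ x i ≤ 1) : 0 ≤ cellMass F ℓ x := by
  refine sum_nonneg fun S _ => ?_
  split_ifs
  · exact mul_nonneg (prod_nonneg fun i _ => (hx i).1) (prod_nonneg fun i _ => sub_nonneg.2 (hx i).2)
  · exact le_rfl

/-! ## Coefficient tables of `LA`, `LB`, `a − b` -/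

/-- Table of a cell polynomial. [this work] -/
def cellA (ℓ : Fin 5) : Array ℤ := tabulate (cellPoly F ℓ)

/-- Evaluation of a tabulated cell. [this work] -/
theorem eval_cellA (ℓ : Fin 5) (x : Fin n → ℝ) : eval (ofTable n 1 (cellA F ℓ)) x = cellMass F ℓ x := by
  rw [cellA, ofTable_tabulate, eval_cellPoly]

/-- Table of a product of three tabulated multi-affine factors (degree `3`). [this work] -/
def prod3 (A B C : Array ℤ) : Array ℤ := prodFinA (n := n) 3 ![A, B, C]

/-- Evaluation of `prod3`. [this work] -/
theorem eval_prod3 (A B C : Array ℤ) (x : Fin n → ℝ) :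
    eval (ofTable n 3 (prod3 (n := n) A B C)) x = eval (ofTable n 1 A) x * eval (ofTable n 1 B) x * eval (ofTable n 1 C) x := by
  rw [prod3, eval_prodFinA, Fin.prod_univ_three]
  rfl

/-- TABLE of `LA = a(ab − e₂(c)) − e₃(c) = a·a·b − a·c₁c₂ − a·c₁c₃ − a·c₂c₃ − c₁c₂c₃` (degree `≤ 3` per variable). [this work] -/
def laArr : Array ℤ :=
  let a := cellA F 4
  let b := cellA F 0
  let c1 := cellA F 1
  let c2 := cellA F 2
  let c3 := cellA F 3
  let aab := prod3 (n := n) a a b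
  let t12 := prod3 (n := n) a c1 c2
  let t13 := prod3 (n := n) a c1 c3
  let t23 := prod3 (n := n) a c2 c3
  let t123 := prod3 (n := n) c1 c2 c3
  tabulate (ofTable n 3 aab - ofTable n 3 t12 - ofTable n 3 t13 - ofTable n 3 t23 - ofTable n 3 t123)

/-- TABLE of `LB = b(ab − e₂(c)) − e₃(c)`. [this work] -/
def lbArr : Array ℤ :=
  let a := cellA F 4
  let b := cellA F 0
  let c1 := cellA F 1
  let c2 := cellA F 2
  let c3 := cellA F 3
  let abb := prod3 (n := n) a b b
  let t12 := prod3 (n := n) b c1 c2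
  let t13 := prod3 (n := n) b c1 c3
  let t23 := prod3 (n := n) b c2 c3
  let t123 := prod3 (n := n) c1 c2 c3
  tabulate (ofTable n 3 abb - ofTable n 3 t12 - ofTable n 3 t13 - ofTable n 3 t23 - ofTable n 3 t123)

/-- TABLE of `a − b` (multi-affine). [this work] -/
def dArr : Array ℤ := tabulate (cellPoly F 4 - cellPoly F 0)

/-- TABLE of `b − a` (multi-affine). [this work] -/
def ndArr : Array ℤ := tabulate (cellPoly F 0 - cellPoly F 4)

/-- Evaluation of the `LA` table. [this work] -/
theorem eval_laArr (x : Fin n → ℝ) :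
    eval (ofTable n 3 (laArr F)) x =
      cellMass F 4 x * (cellMass F 4 x * cellMass F 0 x
        - (cellMass F 1 x * cellMass F 2 x + cellMass F 1 x * cellMass F 3 x + cellMass F 2 x * cellMass F 3 x))
      - cellMass F 1 x * cellMass F 2 x * cellMass F 3 x := by
  simp only [laArr, ofTable_tabulate, eval_sub, eval_prod3, eval_cellA]
  ring

/-- Evaluation of the `LB` table. [this work] -/
theorem eval_lbArr (x : Fin n → ℝ) :
    eval (ofTable n 3 (lbArr F)) x =
      cellMass F 0 x * (cellMass F 4 x * cellMass F 0 x
        - (cellMass F 1 x * cellMass F 2 x + cellMass F 1 x * cellMass F 3 x + cellMass F 2 x * cellMass F 3 x))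
      - cellMass F 1 x * cellMass F 2 x * cellMass F 3 x := by
  simp only [lbArr, ofTable_tabulate, eval_sub, eval_prod3, eval_cellA]
  ring

/-- Evaluation of the `a − b` table. [this work] -/
theorem eval_dArr (x : Fin n → ℝ) : eval (ofTable n 1 (dArr F)) x = cellMass F 4 x - cellMass F 0 x := by
  rw [dArr, ofTable_tabulate, eval_sub, eval_cellPoly, eval_cellPoly]

/-- Evaluation of the `b − a` table. [this work] -/
theorem eval_ndArr (x : Fin n → ℝ) : eval (ofTable n 1 (ndArr F)) x = cellMass F 0 x - cellMass F 4 x := by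
  rw [ndArr, ofTable_tabulate, eval_sub, eval_cellPoly, eval_cellPoly]


/-! ## A decidable sufficient condition for up-sets (for concrete structures) -/

/-- A family of subsets of `Fin n` closed under inserting single coordinates is an up-set. [this work] -/
theorem isUpperSet_of_insert_mem {V : Finset (Finset (Fin n))} (h : ∀ S ∈ V, ∀ i : Fin n, insert i S ∈ V) :
    IsUpperSet ((V : Set (Finset (Fin n)))) := by
  classical
  have key : ∀ T : Finset (Fin n), ∀ S ∈ V, S ∪ T ∈ V := by
    intro T
    induction T using Finset.induction_on with
    | empty => intro S hS; simpa using hS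
    | insert i T hi ih => intro S hS; rw [Finset.union_insert]; exact h _ (ih S hS) i
  intro a b hab ha
  have hb : a ∪ (b \ a) = b := Finset.union_sdiff_of_subset hab
  have := key (b \ a) a ha
  rw [hb] at this
  exact this

/-! ## The region certificate and its soundness -/

/-- **The Bernstein region certificate** for a degree-`3` table `T` on the region `{D ≥ 0}` (`D` a multi-affine table): positive
scale `N` and tables `S₁` (degree `2`), `S₂` (degree `1`) such that `S₁`, `S₂` and `N·T − D·S₁ − D²·S₂` have nonnegative scaled
tensor-Bernstein coefficients (`Bern.certifyA`).  All intermediate products are passed as tables (computed once). [this work] -/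
def certSide (n : ℕ) (T D : Array ℤ) (N : ℕ) (S₁ S₂ : Array ℤ) : Bool :=
  let s1d : Array ℤ := tabulate (mulFast (ofTable n 2 S₁) (ofTable n 1 D))
  let dd : Array ℤ := tabulate (mulFast (ofTable n 1 D) (ofTable n 1 D))
  let s2dd : Array ℤ := tabulate (mulFast (ofTable n 2 dd) (ofTable n 1 S₂))
  let s0 : Array ℤ := tabulate ((N : ℤ) • ofTable n 3 T - ofTable n 3 s1d - ofTable n 3 s2dd)
  decide (0 < N) && (certifyA n 2 S₁ && (certifyA n 1 S₂ && certifyA n 3 s0))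

/-- Evaluation of a tabulated `mulFast` of a degree-`2` and a degree-`1` table (read back at degree `3`). [this work] -/
theorem eval_tab21 (P : Array ℤ) (Q : Array ℤ) (x : Fin n → ℝ) :
    eval (ofTable n 3 (tabulate (mulFast (ofTable n 2 P) (ofTable n 1 Q)))) x = eval (ofTable n 2 P) x * eval (ofTable n 1 Q) x := by
  show eval (ofTable n (2 + 1) (tabulate (mulFast (ofTable n 2 P) (ofTable n 1 Q)))) x = _
  rw [ofTable_tabulate, mulFast_eq, eval_mul]

/-- Evaluation of a tabulated `mulFast` of two multi-affine tables (read back at degree `2`). [this work] -/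
theorem eval_tab11 (P : Array ℤ) (Q : Array ℤ) (x : Fin n → ℝ) :
    eval (ofTable n 2 (tabulate (mulFast (ofTable n 1 P) (ofTable n 1 Q)))) x = eval (ofTable n 1 P) x * eval (ofTable n 1 Q) x := by
  show eval (ofTable n (1 + 1) (tabulate (mulFast (ofTable n 1 P) (ofTable n 1 Q)))) x = _
  rw [ofTable_tabulate, mulFast_eq, eval_mul]

/-- **Soundness of the region certificate**: on the cube, `D(x) ≥ 0 ⟹ T(x) ≥ 0`. [this work] -/
theorem eval_nonneg_of_certSide {T D S₁ S₂ : Array ℤ} {N : ℕ} (h : certSide n T D N S₁ S₂ = true) {x : Fin n → ℝ}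
    (hx : ∀ i, 0 ≤ x i ∧ x i ≤ 1) (hD : 0 ≤ eval (ofTable n 1 D) x) : 0 ≤ eval (ofTable n 3 T) x := by
  simp only [certSide, Bool.and_eq_true, decide_eq_true_eq] at h
  obtain ⟨hN, h1, h2, h0⟩ := h
  have e1 := eval_nonneg_of_certifyA h1 hx
  have e2 := eval_nonneg_of_certifyA h2 hx
  have e0 := eval_nonneg_of_certifyA h0 hx
  rw [ofTable_tabulate, eval_sub, eval_sub, eval_smul, eval_tab21, eval_tab21, eval_tab11] at e0
  have hN' : (0 : ℝ) < (N : ℤ) := by exact_mod_cast hN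
  have key : 0 ≤ ((N : ℤ) : ℝ) * eval (ofTable n 3 T) x := by
    nlinarith [mul_nonneg e1 hD, mul_nonneg (mul_nonneg hD hD) e2]
  exact (mul_nonneg_iff_of_pos_left hN').mp key

/-! ## (C1) from two certificates -/

/-- **(C1) for one sunflower at every bias, from two Bernstein region certificates** (A-side: `LA` on `{a ≥ b}`; B-side: `LB` on
`{b ≥ a}`): for every `x ∈ [0,1]^n`, with `a, b, c_k` the cell masses of `F` under the product measure with biases `x`,
`c₁c₂c₃ ≤ max(a,b)·(ab − (c₁c₂ + c₁c₃ + c₂c₃))`. [this work] -/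
theorem c1_of_certs {NA NB : ℕ} {S₁ S₂ S₁' S₂' : Array ℤ}
    (hA : certSide n (laArr F) (dArr F) NA S₁ S₂ = true) (hB : certSide n (lbArr F) (ndArr F) NB S₁' S₂' = true)
    (x : Fin n → ℝ) (hx : ∀ i, 0 ≤ x i ∧ x i ≤ 1) :
    cellMass F 1 x * cellMass F 2 x * cellMass F 3 x ≤
      max (cellMass F 4 x) (cellMass F 0 x) *
        (cellMass F 4 x * cellMass F 0 x
          - (cellMass F 1 x * cellMass F 2 x + cellMass F 1 x * cellMass F 3 x + cellMass F 2 x * cellMass F 3 x)) := by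
  rcases le_total (cellMass F 0 x) (cellMass F 4 x) with hab | hba
  · rw [max_eq_left hab]
    have hD : 0 ≤ eval (ofTable n 1 (dArr F)) x := by rw [eval_dArr]; linarith
    have h := eval_nonneg_of_certSide hA hx hD
    rw [eval_laArr] at h
    linarith
  · rw [max_eq_right hba]
    have hD : 0 ≤ eval (ofTable n 1 (ndArr F)) x := by rw [eval_ndArr]; linarith
    have h := eval_nonneg_of_certSide hB hx hD
    rw [eval_lbArr] at h
    linarith

/-- The one-sided form, A-side: a certificate for `LA` on `{a ≥ b}` alone gives Lemma A there. [this work] -/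
theorem lemmaA_of_cert {NA : ℕ} {S₁ S₂ : Array ℤ} (hA : certSide n (laArr F) (dArr F) NA S₁ S₂ = true)
    (x : Fin n → ℝ) (hx : ∀ i, 0 ≤ x i ∧ x i ≤ 1) (hab : cellMass F 0 x ≤ cellMass F 4 x) :
    cellMass F 1 x * cellMass F 2 x * cellMass F 3 x ≤
      cellMass F 4 x * (cellMass F 4 x * cellMass F 0 x
        - (cellMass F 1 x * cellMass F 2 x + cellMass F 1 x * cellMass F 3 x + cellMass F 2 x * cellMass F 3 x)) := by
  have hD : 0 ≤ eval (ofTable n 1 (dArr F)) x := by rw [eval_dArr]; linarith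
  have h := eval_nonneg_of_certSide hA hx hD
  rw [eval_laArr] at h
  linarith

end C1Cert

end SafeCalc

end Summit.CriticalPhenomena.PercolationContinuityZ3.Theorems.SunflowerPartition
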